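import Mathlib.RingTheory.Localization.AtPrime.Basic
import Mathlib.RingTheory.Localization.Basic
import Mathlib.Algebra.Module.LocalizedModule.Basic
import Mathlib.Algebra.Module.LocalizedModule.IsLocalization
import HarnessLib

/-!
# Direct summands localize: the retraction `S → R` of a split ring extension passes to `R_P → S_{Λ(R∖P)}`

Support file for crux stmt-ResolutionOfSingularities-15317 (`FrobeniusLadder.FRationalResolution`), line `redirect`,
lead c4 (toric surface programme: the toric surface algebra `k[σ∨ ∩ ℤ²]` is a direct summand of `k[ℕ²]`; to certify that
EVERY STALK of the toric surface has all ideals tightly closed — the weakly-F-regular clause of the crux's rung 4′ — the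
direct-summand structure must be localized at primes; this file is that generic step, Hochster–Huneke 1990 Prop. 4.12).

Given an injective ring map `Λ : R → S` with an additive retraction `ρ : S → R` that is `R`-linear through `Λ`
(`ρ (Λ t) = t`, `ρ (Λ t * g) = t * ρ g`), and a prime `P` of `R`, we produce the localized ring map
`Λ' : R_P → S_T` (`T = Λ(R ∖ P)`) together with an additive retraction `ρ' : S_T → R_P` which is `R_P`-linear
through `Λ'`, and `Λ'` extends `Λ`.  The map `Λ'` is `IsLocalization.map`; the retraction `ρ'` is obtained from
the universal property of localization of MODULES: viewing `S` as an `R`-module through `Λ`, the ring `S_T` is the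
localized module `S_P`, and `ρ'` is `IsLocalizedModule.map` of the `R`-linear map `ρ`.  On fractions,
`Λ' (r / u) = Λ r / Λ u` and `ρ' (s / Λ v) = ρ s / v`, from which the identities follow by `h1`, `h2`.
-/

set_option linter.dupNamespace false

noncomputable section

namespace Summit.ResolutionOfSingularities.ResolutionOfSingularities.Theorems.FRationalResolution

/-- **Direct summands localize** (Hochster–Huneke).  If `Λ : R →+* S` is an injective ring map with an additive
retraction `ρ : S →+ R` satisfying `ρ (Λ t) = t` and `ρ (Λ t * g) = t * ρ g` (so `R` is a direct summand of `S`
as an `R`-module), then for every prime `P` of `R` the localized map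
`Λ' : R_P →+* S_T`, `T = Λ(R ∖ P)`, again admits such a retraction `ρ' : S_T →+ R_P`, and `Λ'` extends `Λ`. -/
theorem stub_retract_localization {R S : Type} [CommRing R] [CommRing S] (Λ : R →+* S) (ρ : S →+ R)
    (hΛ : Function.Injective Λ) (h1 : ∀ t, ρ (Λ t) = t) (h2 : ∀ t g, ρ (Λ t * g) = t * ρ g)
    (P : Ideal R) [P.IsPrime] :
    ∃ (Λ' : Localization.AtPrime P →+* Localization (P.primeCompl.map Λ))
      (ρ' : Localization (P.primeCompl.map Λ) →+ Localization.AtPrime P),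
      Function.Injective Λ' ∧ (∀ t, ρ' (Λ' t) = t) ∧ (∀ t g, ρ' (Λ' t * g) = t * ρ' g) ∧
      ∀ t : R, Λ' (algebraMap R _ t) = algebraMap S _ (Λ t) := by
  -- injectivity of `Λ` is not needed (it follows from `h1`); injectivity of `Λ'` comes from its retraction
  have _ := hΛ
  -- view `S` as an `R`-algebra through `Λ`
  letI : Algebra R S := Λ.toAlgebra
  have hM : P.primeCompl ≤ (P.primeCompl.map Λ).comap Λ := P.primeCompl.le_comap_map
  have hmem : ∀ v : P.primeCompl, Λ v ∈ P.primeCompl.map Λ := fun v => Submonoid.mem_map_of_mem Λ v.2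
  -- (1) the localized ring map `Λ' : R_P → S_T`
  let Λ' : Localization.AtPrime P →+* Localization (P.primeCompl.map Λ) :=
    IsLocalization.map (Localization (P.primeCompl.map Λ)) Λ hM
  have hΛ'mk : ∀ (r : R) (u : P.primeCompl), Λ' (IsLocalization.mk' (Localization.AtPrime P) r u) =
      IsLocalization.mk' (Localization (P.primeCompl.map Λ)) (Λ r) ⟨Λ u, hmem u⟩ :=
    fun r u => IsLocalization.map_mk' hM r u
  -- (2) `S_T` is the localization of the `R`-module `S` at `R ∖ P`
  haveI hloc : IsLocalization (Algebra.algebraMapSubmonoid S P.primeCompl)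
      (Localization (P.primeCompl.map Λ)) := Localization.isLocalization
  haveI hf : IsLocalizedModule P.primeCompl
      (IsScalarTower.toAlgHom R S (Localization (P.primeCompl.map Λ))).toLinearMap := inferInstance
  -- the retraction as an `R`-linear map
  let ρₗ : S →ₗ[R] R :=
    { toFun := ρ
      map_add' := ρ.map_add
      map_smul' := fun t s => h2 t s }
  -- the localized retraction `ρ' : S_T → R_P`
  let ρ' : Localization (P.primeCompl.map Λ) →ₗ[R] Localization.AtPrime P :=
    IsLocalizedModule.map P.primeCompl
      (IsScalarTower.toAlgHom R S (Localization (P.primeCompl.map Λ))).toLinearMap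
      (Algebra.linearMap R (Localization.AtPrime P)) ρₗ
  have hρ'mk : ∀ (s : S) (v : P.primeCompl),
      ρ' (IsLocalization.mk' (Localization (P.primeCompl.map Λ)) s ⟨Λ v, hmem v⟩) =
        IsLocalization.mk' (Localization.AtPrime P) (ρ s) v := by
    intro s v
    have e1 : IsLocalization.mk' (Localization (P.primeCompl.map Λ)) s ⟨Λ v, hmem v⟩ =
        IsLocalizedModule.mk'
          (IsScalarTower.toAlgHom R S (Localization (P.primeCompl.map Λ))).toLinearMap s v :=
      IsLocalization.mk'_algebraMap_eq_mk' (R := R) (S := P.primeCompl) (A := S)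
        (Aₛ := Localization (P.primeCompl.map Λ)) (x := s) (s := v)
    rw [e1]
    exact (IsLocalizedModule.map_mk' P.primeCompl _ _ ρₗ s v).trans
      (IsLocalization.mk'_eq_mk' _ _ (ρ s) v).symm
  -- every element of `S_T` is a fraction `s / Λ v`, every element of `R_P` is a fraction `r / u`
  have hsurjT : ∀ x : Localization (P.primeCompl.map Λ), ∃ (s : S) (v : P.primeCompl),
      x = IsLocalization.mk' (Localization (P.primeCompl.map Λ)) s ⟨Λ v, hmem v⟩ := by
    intro x
    obtain ⟨s, ⟨y, hy⟩, rfl⟩ := IsLocalization.exists_mk'_eq (P.primeCompl.map Λ) x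
    obtain ⟨v, hv, rfl⟩ := Submonoid.mem_map.mp hy
    exact ⟨s, ⟨v, hv⟩, rfl⟩
  have hsurjP : ∀ t : Localization.AtPrime P, ∃ (r : R) (u : P.primeCompl),
      t = IsLocalization.mk' (Localization.AtPrime P) r u := fun t =>
    let ⟨r, u, h⟩ := IsLocalization.exists_mk'_eq P.primeCompl t
    ⟨r, u, h.symm⟩
  -- (3a) `ρ' ∘ Λ' = id`
  have ha : ∀ t, ρ' (Λ' t) = t := by
    intro t
    obtain ⟨r, u, rfl⟩ := hsurjP t
    rw [hΛ'mk, hρ'mk, h1]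
  -- (3b) `ρ'` is `R_P`-linear through `Λ'`
  have hb : ∀ t x, ρ' (Λ' t * x) = t * ρ' x := by
    intro t x
    obtain ⟨r, u, rfl⟩ := hsurjP t
    obtain ⟨s, v, rfl⟩ := hsurjT x
    have e2 : (⟨Λ u, hmem u⟩ : P.primeCompl.map Λ) * ⟨Λ v, hmem v⟩ = ⟨Λ ↑(u * v), hmem (u * v)⟩ :=
      Subtype.ext (by simp)
    rw [hΛ'mk, hρ'mk, ← IsLocalization.mk'_mul (Localization (P.primeCompl.map Λ)), e2, hρ'mk, h2,
      IsLocalization.mk'_mul]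
  -- (4) assemble; injectivity of `Λ'` from the left inverse `ρ'`
  refine ⟨Λ', ρ'.toAddMonoidHom, ?_, ha, hb, fun t => IsLocalization.map_eq hM t⟩
  exact Function.LeftInverse.injective (g := ρ') (f := Λ') ha

end Summit.ResolutionOfSingularities.ResolutionOfSingularities.Theorems.FRationalResolution

end
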